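import Literature.MathematicalPhysics.QuantumLattice.HubbardOpenBoxWeightedClusterOracle
import Literature.MathematicalPhysics.QuantumLattice.HubbardNNNHoppingWeightedClusterLowerBound
import HarnessLib

/-!
# Coded bond sums of rank-table weights, and the `2 × 3` weighted Anderson bound from kernel certificates

Topic `MathematicalPhysics/QuantumLattice`, family `hubbard`. The weighted Anderson cover law
`ClusterLowerBound.energyDensityTT'_ge_of_boxFloorsW_2x3` (Valentí–Stolze–Hirschfeld 1991 §II;
`HubbardNNNHoppingWeightedClusterLowerBound`) has five bookkeeping hypotheses on the weights — the directional
bond sums `wsumV τ + wsumH τ = t`, `2·wsumD₁ τ = t'`, `2·wsumD₂ τ = t'`, `2·Σ υ = U`, `Σ ν = 0`. For weights read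
from INTEGER TABLES on the row-major site ranks (`τ x y = W (rk x) (rk y)/Q`, …; the format of the kernel ED
certificates of `HubbardOpenBoxWeightedClusterOracle`) these sums are structural integer sums the kernel decides:

* §1 `wsumVCode / wsumHCode / wsumD₁Code / wsumD₂Code c N W` (coded direction predicates by `div / mod` on the
  ranks, matching `siteRank_div_mod`) and the bridges **`wsumV_siteRank_div`** etc., `sum_siteRank_div`;
* §2 the packaged certificate form **`energyDensityTT'_ge_of_weightedKCerts_2x3`**: a kernel floor table
  `σ k ≤ E₀(h^W_{2×3}(symW W₀/Q, V/Q, M/Q), k)` (e.g. from `groundEnergy_ge_of_kCertsW₃`) and the five integer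
  identities ⇒ the hypothesis-free affine density row `2m − 12μ·n ≤ e(t, t', U; n)`.

Everything is proved; no named fact; nothing numerical is asserted here.

## References

* R. Valentí, J. Stolze, P. J. Hirschfeld, Phys. Rev. B 43 (1991) 13743, §II. [cite: ValentiStolzeHirschfeld1991, §II]
* H. Q. Lin, J. E. Gubernatis, Comput. Phys. 7 (1993) 400, §II (row-major site ranks). [cite: LinGubernatis1993, §II]
* P. W. Anderson, Phys. Rev. 83 (1951) 1260, eq. (2). [cite: Anderson1951, eq. (2)]
-/

noncomputable section

namespace Literature.MathematicalPhysics.QuantumLattice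

namespace OccupationCode

open Finset Matrix ClusterLowerBound ThermodynamicLimit

/-! ### §1 Coded directional bond sums -/

/-- Coded total weight of the `+e₁` bonds `(i, j) → (i+1, j)`: `Σ_{P,Q<N} [Q/c = P/c + 1 ∧ Q%c = P%c] W P Q`.
[cite: ValentiStolzeHirschfeld1991, §II] -/
def wsumVCode (c N : ℕ) (W : ℕ → ℕ → ℤ) : ℤ :=
  sumNat (fun P => sumNat (fun Q => if Q / c = P / c + 1 ∧ Q % c = P % c then W P Q else 0) N) N

/-- Coded total weight of the `+e₂` bonds `(i, j) → (i, j+1)`. [cite: ValentiStolzeHirschfeld1991, §II] -/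
def wsumHCode (c N : ℕ) (W : ℕ → ℕ → ℤ) : ℤ :=
  sumNat (fun P => sumNat (fun Q => if Q / c = P / c ∧ Q % c = P % c + 1 then W P Q else 0) N) N

/-- Coded total weight of the `e₁ + e₂` diagonal bonds `(i, j) → (i+1, j+1)`. [cite: ValentiStolzeHirschfeld1991, §II] -/
def wsumD₁Code (c N : ℕ) (W : ℕ → ℕ → ℤ) : ℤ :=
  sumNat (fun P => sumNat (fun Q => if Q / c = P / c + 1 ∧ Q % c = P % c + 1 then W P Q else 0) N) N

/-- Coded total weight of the `e₁ − e₂` diagonal bonds `(i, j+1) → (i+1, j)`. [cite: ValentiStolzeHirschfeld1991, §II] -/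
def wsumD₂Code (c N : ℕ) (W : ℕ → ℕ → ℤ) : ℤ :=
  sumNat (fun P => sumNat (fun Q => if Q / c = P / c + 1 ∧ P % c = Q % c + 1 then W P Q else 0) N) N

section Box

variable {r c : ℕ}

/-- A double site sum of a rank function with a coded condition is the structural double sum. [cite: LinGubernatis1993, §II] -/
private theorem sum_sum_siteRank_ite (cond : ℕ → ℕ → Prop) [DecidableRel cond] (W : ℕ → ℕ → ℤ) (q : ℝ) :
    (∑ x : Fin r ×ₗ Fin c, ∑ y : Fin r ×ₗ Fin c,
        if cond (siteRank x) (siteRank y) then (W (siteRank x) (siteRank y) : ℝ) / q else 0) =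
      ((sumNat (fun P => sumNat (fun Q => if cond P Q then W P Q else 0) (r * c)) (r * c) : ℤ) : ℝ) / q := by
  rw [sumNat_eq, Int.cast_sum, Finset.sum_div, ← sumNat_eq,
    ← sum_site_eq_sumNat (fun P => ((sumNat (fun Q => if cond P Q then W P Q else 0) (r * c) : ℤ) : ℝ) / q)]
  refine Finset.sum_congr rfl fun x _ => ?_
  rw [sumNat_eq, Int.cast_sum, Finset.sum_div, ← sumNat_eq,
    ← sum_site_eq_sumNat (fun Q => ((if cond (siteRank x) Q then W (siteRank x) Q else 0 : ℤ) : ℝ) / q)]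
  refine Finset.sum_congr rfl fun y _ => ?_
  split_ifs <;> simp

/-- **`wsumV` of rank-table weights is the coded sum**: `wsumV (W(rk ·)(rk ·)/q) = wsumVCode c (rc) W / q`.
[cite: ValentiStolzeHirschfeld1991, §II] -/
theorem wsumV_siteRank_div (W : ℕ → ℕ → ℤ) (q : ℝ) :
    wsumV (r := r) (c := c) (fun x y => (W (siteRank x) (siteRank y) : ℝ) / q) = (wsumVCode c (r * c) W : ℝ) / q := by
  rw [wsumVCode, ← sum_sum_siteRank_ite]
  unfold wsumV
  refine Finset.sum_congr rfl fun x _ => Finset.sum_congr rfl fun y _ => ?_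
  obtain ⟨h1, h2⟩ := siteRank_div_mod x
  obtain ⟨h3, h4⟩ := siteRank_div_mod y
  have e : (siteRank y / c = siteRank x / c + 1 ∧ siteRank y % c = siteRank x % c) ↔
      (((ofLex x).1 : ℕ) + 1 = (ofLex y).1 ∧ (ofLex x).2 = (ofLex y).2) := by
    rw [h1, h2, h3, h4, Fin.ext_iff]; omega
  by_cases h : ((ofLex x).1 : ℕ) + 1 = (ofLex y).1 ∧ (ofLex x).2 = (ofLex y).2
  · rw [if_pos h, if_pos (e.2 h)]
  · rw [if_neg h, if_neg (fun h' => h (e.1 h'))]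

/-- **`wsumH` of rank-table weights is the coded sum.** [cite: ValentiStolzeHirschfeld1991, §II] -/
theorem wsumH_siteRank_div (W : ℕ → ℕ → ℤ) (q : ℝ) :
    wsumH (r := r) (c := c) (fun x y => (W (siteRank x) (siteRank y) : ℝ) / q) = (wsumHCode c (r * c) W : ℝ) / q := by
  rw [wsumHCode, ← sum_sum_siteRank_ite]
  unfold wsumH
  refine Finset.sum_congr rfl fun x _ => Finset.sum_congr rfl fun y _ => ?_
  obtain ⟨h1, h2⟩ := siteRank_div_mod x
  obtain ⟨h3, h4⟩ := siteRank_div_mod y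
  have e : (siteRank y / c = siteRank x / c ∧ siteRank y % c = siteRank x % c + 1) ↔
      ((ofLex x).1 = (ofLex y).1 ∧ ((ofLex x).2 : ℕ) + 1 = (ofLex y).2) := by
    rw [h1, h2, h3, h4, Fin.ext_iff]; omega
  by_cases h : (ofLex x).1 = (ofLex y).1 ∧ ((ofLex x).2 : ℕ) + 1 = (ofLex y).2
  · rw [if_pos h, if_pos (e.2 h)]
  · rw [if_neg h, if_neg (fun h' => h (e.1 h'))]

/-- **`wsumD₁` of rank-table weights is the coded sum.** [cite: ValentiStolzeHirschfeld1991, §II] -/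
theorem wsumD₁_siteRank_div (W : ℕ → ℕ → ℤ) (q : ℝ) :
    wsumD₁ (r := r) (c := c) (fun x y => (W (siteRank x) (siteRank y) : ℝ) / q) = (wsumD₁Code c (r * c) W : ℝ) / q := by
  rw [wsumD₁Code, ← sum_sum_siteRank_ite]
  unfold wsumD₁
  refine Finset.sum_congr rfl fun x _ => Finset.sum_congr rfl fun y _ => ?_
  obtain ⟨h1, h2⟩ := siteRank_div_mod x
  obtain ⟨h3, h4⟩ := siteRank_div_mod y
  have e : (siteRank y / c = siteRank x / c + 1 ∧ siteRank y % c = siteRank x % c + 1) ↔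
      (((ofLex x).1 : ℕ) + 1 = (ofLex y).1 ∧ ((ofLex x).2 : ℕ) + 1 = (ofLex y).2) := by
    rw [h1, h2, h3, h4]; omega
  by_cases h : ((ofLex x).1 : ℕ) + 1 = (ofLex y).1 ∧ ((ofLex x).2 : ℕ) + 1 = (ofLex y).2
  · rw [if_pos h, if_pos (e.2 h)]
  · rw [if_neg h, if_neg (fun h' => h (e.1 h'))]

/-- **`wsumD₂` of rank-table weights is the coded sum.** [cite: ValentiStolzeHirschfeld1991, §II] -/
theorem wsumD₂_siteRank_div (W : ℕ → ℕ → ℤ) (q : ℝ) :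
    wsumD₂ (r := r) (c := c) (fun x y => (W (siteRank x) (siteRank y) : ℝ) / q) = (wsumD₂Code c (r * c) W : ℝ) / q := by
  rw [wsumD₂Code, ← sum_sum_siteRank_ite]
  unfold wsumD₂
  refine Finset.sum_congr rfl fun x _ => Finset.sum_congr rfl fun y _ => ?_
  obtain ⟨h1, h2⟩ := siteRank_div_mod x
  obtain ⟨h3, h4⟩ := siteRank_div_mod y
  have e : (siteRank y / c = siteRank x / c + 1 ∧ siteRank x % c = siteRank y % c + 1) ↔
      (((ofLex x).1 : ℕ) + 1 = (ofLex y).1 ∧ ((ofLex y).2 : ℕ) + 1 = (ofLex x).2) := by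
    rw [h1, h2, h3, h4]; omega
  by_cases h : ((ofLex x).1 : ℕ) + 1 = (ofLex y).1 ∧ ((ofLex y).2 : ℕ) + 1 = (ofLex x).2
  · rw [if_pos h, if_pos (e.2 h)]
  · rw [if_neg h, if_neg (fun h' => h (e.1 h'))]

/-- A site sum of a rank-table weight is the structural sum: `Σ_x V(rk x)/q = (sumNat V (rc))/q`. [cite: LinGubernatis1993, §II] -/
theorem sum_siteRank_div (V : ℕ → ℤ) (q : ℝ) :
    ∑ x : Fin r ×ₗ Fin c, (V (siteRank x) : ℝ) / q = ((sumNat V (r * c) : ℤ) : ℝ) / q := by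
  rw [sumNat_eq, Int.cast_sum, Finset.sum_div, ← sumNat_eq, ← sum_site_eq_sumNat (fun P => ((V P : ℤ) : ℝ) / q)]

end Box

/-! ### §2 The weighted `2 × 3` Anderson bound from a kernel floor table -/

/-- **Weighted `2 × 3` Anderson bound from kernel certificates (packaged form).** For integer weight tables
`W₀` (symmetrised by `symW`), `V`, `M` and a denominator `Q > 0`: a floor table
`σ k ≤ E₀(h^W_{2×3}(symW W₀/Q, V/Q, M/Q), k)` (`k ≤ 12`; e.g. `groundEnergy_ge_of_kCertsW₃`) together with the integer
bookkeeping identities `wsumVCode + wsumHCode = t·Q`, `2·wsumD₁Code = t'·Q`, `2·wsumD₂Code = t'·Q`, `2·Σ V = U·Q`,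
`Σ M = 0` and a supporting line `m ≤ σ k + μ k` gives the HYPOTHESIS-FREE affine density row
`2m − 12μ·n ≤ e(t, t', U; n)` (`0 ≤ n < 2`, `0 ≤ U`) — Valentí–Stolze–Hirschfeld's weighted Anderson cover.
[cite: ValentiStolzeHirschfeld1991, §II] [cite: Anderson1951, eq. (2)] -/
theorem energyDensityTT'_ge_of_weightedKCerts_2x3 (W₀ : ℕ → ℕ → ℤ) (V M : ℕ → ℤ) {Q : ℕ} (hQ : 0 < Q)
    {σ : ℕ → ℝ}
    (hF : ∀ k ≤ 12, σ k ≤ groundEnergy (hubbardOpenBoxTT'W 2 3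
      (fun x y => (symW W₀ (siteRank x) (siteRank y) : ℝ) / Q) (fun x => (V (siteRank x) : ℝ) / Q)
      (fun x => (M (siteRank x) : ℝ) / Q)) k)
    {t t' U : ℝ} (ht : ((wsumVCode 3 6 (symW W₀) + wsumHCode 3 6 (symW W₀) : ℤ) : ℝ) = t * Q)
    (hd₁ : ((2 * wsumD₁Code 3 6 (symW W₀) : ℤ) : ℝ) = t' * Q) (hd₂ : ((2 * wsumD₂Code 3 6 (symW W₀) : ℤ) : ℝ) = t' * Q)
    (hU : ((2 * sumNat V 6 : ℤ) : ℝ) = U * Q) (hν : sumNat M 6 = 0) (hU0 : 0 ≤ U)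
    (μ m : ℝ) (hm : ∀ k ≤ 12, m ≤ σ k + μ * k) {n : ℝ} (hn0 : 0 ≤ n) (hn2 : n < 2) :
    2 * m - 12 * μ * n ≤ energyDensityTT' t t' U n := by
  have hQ' : (Q : ℝ) ≠ 0 := by exact_mod_cast hQ.ne'
  refine energyDensityTT'_ge_of_boxFloorsW_2x3 (fun x y => by rw [symW_symm]) hF ?_ ?_ ?_ ?_ ?_ hU0 μ m hm hn0 hn2
  · rw [wsumV_siteRank_div, wsumH_siteRank_div, ← add_div, div_eq_iff hQ']
    exact_mod_cast ht
  · rw [wsumD₁_siteRank_div, mul_div_assoc', div_eq_iff hQ']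
    exact_mod_cast hd₁
  · rw [wsumD₂_siteRank_div, mul_div_assoc', div_eq_iff hQ']
    exact_mod_cast hd₂
  · rw [sum_siteRank_div, mul_div_assoc', div_eq_iff hQ']
    exact_mod_cast hU
  · rw [sum_siteRank_div, show (2 * 3 : ℕ) = 6 from rfl, hν]
    simp

end OccupationCode

end Literature.MathematicalPhysics.QuantumLattice
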